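import Literature.MathematicalPhysics.QuantumFieldTheory.Balaban1983to89.B8Ineq198MultiLevelTorusL0
import Literature.MathematicalPhysics.QuantumFieldTheory.Balaban1983to89.B6Prop22MultiLevelTorusL0
import Literature.MathematicalPhysics.QuantumFieldTheory.Balaban1983to89.B6Prop22DerivMultiLevelTorusL0
import Literature.MathematicalPhysics.QuantumFieldTheory.Balaban1983to89.B6Prop22AdjMultiLevelTorusL0
import Literature.MathematicalPhysics.QuantumFieldTheory.Balaban1983to89.B6Prop22LapMultiLevelTorusL0

/-!
# `Balaban1983to89.B8Ineq198MultiLevelTorusP22L0` — LEVEL-0 TWIN (programme G-F3′-L0's dictionary; UV3-NODE (P2-L3) ∕ P1♭ `core` junction J-N05♭, J1 of LEAD-H ★w5-19200 g4's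
T2♭-PLAN v1.1, RULING L-2 (2)) of `B8Ineq198MultiLevelTorusP22`: the SAME declarations (`prop22_entries1236_multiLevelTorus`, `ineq198R_multiLevelTorus_P22`, `ineq1101_GR_multiLevelTorus_P22`, `ineq198R_multiLevelTorus_msup_P22`, …), SAME NAMES, for lit-balaban's LEVEL-0-ADMITTING torus families
`B6MultiLevelTorusOperatorL0.TDomains` (blocks of every level `0 ≤ j ≤ k`, print p.225 (2.14) «Σ_{j=0}^k … (Q′₀λ)(x) = λ(x), x ∈ Λ₀» — the families the H-side P2 port
`FlatPort*L0∕AllL` reads), obtained by the dictionary swap `…MultiLevelTorus ↦ …MultiLevelTorusL0` of every parent (all ✓ in the tree; the L0 Prop.-2.2∕2.3 suppliers' weight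
windows quantify over EVERY level `i` incl. `0`, so the level-`≥ 1` window binders of the originals lose their `1 ≤ i` guard).  Unit `ym-inputs-p09` (cell `pub/ym-inputs`,
H-side hand of cell `ym3-torus`), 2026-08-28.  No `def`, no new fact, standard axioms; every input BY NAME.  NOT summit progress; rung R3 bookkeeping, not Clay.
THE TWIN'S DOCUMENTATION FOLLOWS VERBATIM.

# `Balaban1983to89.B8Ineq198MultiLevelTorusP22` — T. Bałaban, *Spaces of regular gauge field configurations on a lattice and gauge
# fixing conditions*, Commun. Math. Phys. **99** (1985) 75–102 [Balaban1985RegularSpaces], p. 92 (1.98) R-half «|Rf|₍₋₂₎ ≦ B′₀|f|₍₋₂₎»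
# and p. 93 (1.101) «G′ is a bounded operator from a space with the norm |·|₍₋₂₎ into a space with the norm |·| for functions, and the
# norm |·|₍₋₁₎ for their first derivatives» AT U₀ = 1 ON THE `k`-LEVEL TORUS FAMILY — THE [B6] PROP. 2.2 TORUS ENTRIES 1, 2, 3, 6
# DISCHARGED BY NAME (p21's T4 `prop22_first_multiLevelTorus`, T6 `prop22_second_multiLevelTorus`, T7 `prop22_third_multiLevelTorus`,
# T5 `prop22_sixth_multiLevelTorus`): **(1.101) HYPOTHESIS-FREE ON PRINT'S CARRIER**, (1.98) R-half and the composite `G′R` with only the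
# inverse `(Q′G′²Q′*)⁻¹` left as an argument

statement-level skeleton of published theorems with citation tags; proofs where landed; nothing here is a claim about the Yang–Mills mass gap

CITATION HEADER (lean-in-tree rule).  Cell `lit-balaban`, unit `lit-balaban-r05` gen 54 (B8 owner; the successor step announced in the
module docstring of `B8Ineq198MultiLevelTorus`, p344001).  WHAT IS REPRODUCED = rows **B8.Eq1.101** (the G′ sentence of p. 93),
**B8.Eq1.99** member (1.98) R-half and **B8.Claim@92** (weighted form) on print's carrier `T_η` at the flat background, NOW WITH THE
GENUINE PROP.-2.2 MAJORANTS OF `G′ = gmlT`: the theorems of `B8Ineq198MultiLevelTorus` take the [B6] Prop. 2.2 torus entries 1, 2, 3, 6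
as arguments; p21's `B6Prop22MultiLevelTorus.prop22_first_multiLevelTorus` (T4, p342287), `B6Prop22DerivMultiLevelTorus.
prop22_second_multiLevelTorus` (T6, p343094; `∇_μ = dT N₀ μ = S_{e_μ} − 1`, the periodic forward difference),
`B6Prop22AdjMultiLevelTorus.prop22_third_multiLevelTorus` (T7, p343913; `G′∇_μ^*` as `gmlT · (dT N₀ μ)ᵀ`) and
`B6Prop22LapMultiLevelTorus.prop22_sixth_multiLevelTorus` (T5, p342798; `−Δ_T = perLapT N₀`) PROVE them for every member of the
family under print's regime (`M_h ≥ 3`, «M large» `L·M_h ≥ M₀`, `R ≥ 2L`, `RM ≥ N₀ + 1`, torus size `P_μ ≥ 4`, weights in the windows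
`[a₋, a₊]`, `[c₋, c₊]` with `a_{i+1} = aNext ℓ a_i c_i`).  §1 merges the four packages to one rate and one set of constants /
thresholds (the torus analogue of p21's `B6Prop22AllMultiLevelBox.prop22_entries1236_multiLevelBox`, stated consumer-side; if p21
lands a `B6Prop22AllMultiLevelTorus`, that is the package of record); §§2–5 substitute it.  Theorems only; every input BY NAME; 0 sorry.

WHAT IS PRINTED (verbatim).  p. 92 [PDF 18]: *"The operators R and V are bounded in this norm, and we have |Rf|₍₋₂₎ ≦ B′₀|f|₍₋₂₎,
|Vf|₍₋₂₎ ≦ O(α₄)|f|₍₋₂₎. (1.98)"*; p. 93 [PDF 19]: *"One of the results of [4], Theorem 3.1, tells us that G′ is a bounded operator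
from a space with the norm |·|₍₋₂₎ into a space with the norm |·| for functions, and the norm |·|₍₋₁₎ for their first derivatives.
Thus we have |G′R𝔉(λ, Dλ, A, D\*A)|, |DG′R𝔉(λ, Dλ, A, D\*A)|₍₋₁₎ ≦ O(1)B′₀ξ₁(α₀ + α₁ + 3α₄²) on Ω_j (1.101)"*; [B6] CMP **96**
[Balaban1984PropagatorsII] Prop. 2.2 (2.67) p. 234 «|(G′λ)(x)|, |(∇^η_xG′λ)(x)|, |(G′∇^{η*}λ)(x)|, …, |(Δ^ηG′λ)(x)| ≦ O(1)[(Lʲη)², Lʲη,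
Lʲη, …, 1]e^{−½δ₀d(y,y′)}|λ|», Prop. 2.3 (2.87) p. 238, p. 224 «we admit the case when some domains Ω_j are equal to T_η»; [4] CMP
**99** [Balaban1985BackgroundPropagators] (3.41) p. 397, (3.47) p. 398, (3.49) p. 399, (3.25) p. 394.

WHAT THIS FILE PROVES (theorems only; imports `B8Ineq198MultiLevelTorus` and p21's T5/T7 (⊇ T4, T6)).
* §1 **`prop22_entries1236_multiLevelTorus`** — ONE set `δ₀, C, M₀ > 0`, `N₀ ≥ 1` for which every member of the torus family in
  print's regime has the FIRST (`C·L^{2j}`), SECOND (`C·Lʲ`, `dT N₀ μ·G′`, every axis), THIRD (`C·Lʲ`, `G′·(dT N₀ μ)ᵀ`, every axis)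
  and SIXTH (`C`, `perLapT N₀·G′`) majorants of (2.67) at the rate `½δ₀` in `d_T` (merge of T4/T6/T7/T5 at the smallest rate and the
  largest constant / thresholds).
* §2 **`ineq198R_multiLevelTorus_P22`** — (1.98) R-half (every exponent `n`) on `T_η` with entry 1 DISCHARGED: only `G = (Q′G′²Q′*)⁻¹`
  with its (2.87)-bound remains an argument.
* §3 **`ineq1101_multiLevelTorus_P22`** (every `n`) and **`ineq1101_multiLevelTorus_two_P22`** (`n = 2`, THE PRINTED SENTENCE) —
  **(1.101) AT U₀ = 1 ON PRINT'S CARRIER, HYPOTHESIS-FREE**: for the genuine multi-level torus `G′ = gmlT`, `∇_μ = dT N₀ μ`,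
  `−Δ_T = perLapT N₀`: `|G′f| ≦ C′(Lʲ)^{2−n}S`, `|∇_μG′f| ≦ C′(Lʲ)^{1−n}S`, `|G′∇_μ^*f| ≦ C′(Lʲ)^{1−n}S`, `|(−Δ_T)G′f| ≦ C′(Lʲ)^{−n}S`
  whenever `|f(z)| ≦ S(L^{j(z)})⁻ⁿ`, for every member of the family in print's regime — no majorant, no inverse, no `G`.
* §4 **`ineq1101_GR_multiLevelTorus_P22`** — the composite letter `G′R` of (1.100)–(1.101) with the entries discharged (`G` remains).
* §5 **`ineq198R_multiLevelTorus_msup_P22`**, **`ineq1101_multiLevelTorus_msup_P22`** — the same in print's own p. 86 norm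
  `B8ScaledSupNorm.msup` (`|Rf|₍₋ₙ₎ ≦ B′₀|f|₍₋ₙ₎`; `|G′f|₍₀₎, |∇_μG′f|₍₋₁₎, |G′∇_μ^*f|₍₋₁₎, |(−Δ_T)G′f|₍₋₂₎ ≦ C′|f|₍₋₂₎` HYPOTHESIS-FREE).

HONEST SCOPE / NOT CLAIMED.  Model instance at U₀ = 1 on p21's torus family (levels `1 … k`, `Ω₁ = T_η`, `m² = 0`, lattice units
`η = 1` at the finest level, `x ∈ Ω_j` read at the point's own level `j = D.lev x`; print's regime hypotheses `M_h ≥ 3`, `L·M_h ≥ M₀`,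
`R ≥ 2L`, `RM ≥ N₀ + 1`, `P_μ ≥ 4`, weight windows now explicit because the Prop.-2.2 theorems carry them); in §2/§4/§5-(1.98) the
inverse `(Q′G′²Q′*)⁻¹` is still the argument `G` with its printed (2.87)-bound (a torus Prop. 2.3 is not in the tree); constants
existential.  The general statements at a regular background `U₀ ∈ 𝔄_k` ([4] Thms 3.1–3.3) stay the typed leaves / function-level
theorems of `B8Ineq198R`, `B8Ineq192Op`, `B9Ineq347AllEntries`; rows B8.Claim@92 / B8.Eq1.99 / B8.Eq1.101 heads are NOT changed by
this instance.  NOT summit progress, NOT continuum, NOT Clay.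
-/

namespace Literature.MathematicalPhysics.QuantumFieldTheory.Balaban1983to89.B8Ineq198MultiLevelTorusP22L0

open Finset Matrix
open B4Reflection242 (boxDom)
open B6MultiLevelBoxOperator hiding Domains mlOp_apply
open B6MultiLevelBoxOperatorL0
open B6MultiLevelTorusOperator hiding TDomains mlOpT_apply mlOpT_eq_reindex_chart mlOpT_mul_reindex mlOpT_tshift
open B6MultiLevelTorusOperatorL0
open B6Geom246MultiLevelBox hiding Touch blkOf blkOf_corner blkOf_eq_iff_blk blkOf_eq_of_blk_i_eq blkOf_val bond bond_adj bset cen connected coord_bounds corner corner_mem csys dist_blkOf_le_box dist_blkOf_le_coord dist_blkOf_le_line dist_cen_le_of_adj dist_cen_le_of_touch dist_le_one_of_near dist_toR_cen_le exists_blkOf_eq geom lemma21_box lev_corner lev_eq_of_blkOf_eq levelGap pack reachable_blkOf reachable_of_near realizes scale_bounds touch_symm triangle_refl_nonneg walk_disp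
open B6Geom246MultiLevelBoxL0
open B6Geom246MultiLevelTorus hiding TouchT blkHom blkMap blkMap_blkOf blkMap_injective blkMap_surjective blkOf_tshift_eq bondT bondT_adj bond_le_bondT connectedT csysT distT_le_dist_box distT_le_dist_chart dist_posT_le_of_adj dist_posT_le_of_touchT dist_site_posT_le geomT label_bounds lemma21_torus levelGapT packT posT realizesT touchT_symm triangle_refl_nonneg_T walk_dispT
open B6Geom246MultiLevelTorusL0
open B6Ineq268MultiLevelBox hiding QB QB_apply QsB QsB_apply W W_eq W_pos Xk abs_qB abs_qB_le card_blkOf_le csysB geomB geomB_L geomB_M geomB_R geomB_RM geomB_RM_nonneg geomB_Site geomB_dist geomB_eta geomB_len geom_len ineq268_multiLevelBox instDecidableEqGeomBSite kerOp_Xk levelSepB qB qB_ne_zero realizesB refl_nonnegB sum_abs_qB_le symmB triangleB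
open B6Ineq268MultiLevelBoxL0
open B6RandomWalk (HasMajorant BlockSupp hasMajorant_mono)
open B6Ineq261LevelGap (K261 K261_nonneg theta_lt_one_of_log)
open B6Expansion282 (kerOp)
open B6Prop23Chain (mat)
open B8Ineq192MultiLevelBox (abs_apply_le_of_levelBound levelRowSum_le ineq261With_of_le)
open B8Ineq192MultiLevelTorusL0
open B9Ineq349MultiLevelTorusL0 (pProjMLT rProjMLT_eq_one_sub_pProjMLT ineq349_multiLevelTorus)
open B6Ineq243TwoLevelBox (aNext)
open B6Prop22MultiLevelTorusL0 (prop22_first_multiLevelTorus)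
open B6Prop22DerivMultiLevelTorus (dT)
open B6Prop22DerivMultiLevelTorusL0 (prop22_second_multiLevelTorus)
open B6Prop22AdjMultiLevelTorusL0 (prop22_third_multiLevelTorus)
open B6Prop22LapMultiLevelTorusL0 (prop22_sixth_multiLevelTorus)
open B8ScaledSupNorm (msup)
open B8Ineq198MultiLevelTorusL0

noncomputable section

variable {d : ℕ}

/-! ## §1  The four torus entries 1, 2, 3, 6 of (2.67) with common constants -/

/-- **[B6] PROPOSITION 2.2, ENTRIES 1, 2, 3, 6 OF (2.67) WITH COMMON CONSTANTS, FOR THE GENUINE `k`-LEVEL OPERATOR `G′ = Δ′_a⁻¹` ON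
THE TORUS `T_η`** («|(G′λ)(x)|, |(∇^η_xG′λ)(x)|, |(G′∇^{η*}λ)(x)|, …, |(Δ^ηG′λ)(x)| ≦ O(1)[(Lʲη)², Lʲη, Lʲη, …, 1]e^{−½δ₀d(y,y′)}|λ|»):
ONE set `δ₀, C, M₀ > 0`, `N₀ ≥ 1` (functions of `d`, `ℓ`, the windows) such that for every `k`, `M_h ≥ 3` with `L·M_h ≥ M₀`, `R ≥ 2L`
with `RM ≥ N₀ + 1`, torus size `P` (`P_μ ≥ 4`), nested torus family `D` with (2.1)–(2.2) and weights in the windows with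
`a_{i+1} = aNext ℓ a_i c_i`: the first (`C·L^{2j}`), second (`C·Lʲ`, `∂_μG′`, every axis), third (`C·Lʲ`, `G′∂_μ^*`, every axis) and
sixth (`C`, `(−Δ_T)G′`) majorants hold at the rate `½δ₀` in `d_T` — the conjunction of p21's `prop22_first/second/third/sixth_
multiLevelTorus` at the smallest rate and the largest constant / thresholds (torus analogue of
`B6Prop22AllMultiLevelBox.prop22_entries1236_multiLevelBox`).
[cite: Balaban1984PropagatorsII, Proposition 2.2 (2.67) p.234 (entries 1, 2, 3, 6), p.224 (Ω₁ = T_η admitted)] -/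
theorem prop22_entries1236_multiLevelTorus (d ℓ : ℕ) (hℓ : 1 ≤ ℓ) (aminus aplus a2minus a2plus : ℝ) (ha : 0 < aminus)
    (ha2 : 0 < a2minus) :
    ∃ δ₀ C M₀ : ℝ, ∃ N₀ : ℕ, 0 < δ₀ ∧ 0 < C ∧ 0 < M₀ ∧ 0 < N₀ ∧
      ∀ (k Mh R : ℕ), 3 ≤ Mh → M₀ ≤ ((ℓ : ℝ) + 1) * Mh → 2 * (ℓ + 1) ≤ R → N₀ + 1 ≤ R * ((ℓ + 1) * Mh) →
      ∀ (P : Fin (d + 1) → ℕ) (_hP : ∀ μ, 1 ≤ P μ) (_hP4 : ∀ μ, 4 ≤ P μ) (D : B6MultiLevelTorusOperatorL0.TDomains d ℓ Mh k P R) (a c : ℕ → ℝ),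
        (∀ i, aminus ≤ a i ∧ a i ≤ aplus) → (∀ i, a2minus ≤ c i ∧ c i ≤ a2plus) →
        (∀ i, a (i + 1) = aNext ℓ (a i) (c i)) →
        HasMajorant (g := geomT D) (blkOf D.toDomains) (Matrix.toLin' (gmlT (N0 ℓ Mh k P) ℓ k D.lev a))
          (fun y y' => C * ((ℓ : ℝ) + 1) ^ (2 * y.1.1) * Real.exp (-(δ₀ / 2 * (geomT D).dist y y'))) ∧
        (∀ μ : Fin (d + 1), HasMajorant (g := geomT D) (blkOf D.toDomains)
          (Matrix.toLin' (dT (N0 ℓ Mh k P) μ * gmlT (N0 ℓ Mh k P) ℓ k D.lev a))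
          (fun y y' => C * ((ℓ : ℝ) + 1) ^ y.1.1 * Real.exp (-(δ₀ / 2 * (geomT D).dist y y')))) ∧
        (∀ μ : Fin (d + 1), HasMajorant (g := geomT D) (blkOf D.toDomains)
          (Matrix.toLin' (gmlT (N0 ℓ Mh k P) ℓ k D.lev a * (dT (N0 ℓ Mh k P) μ)ᵀ))
          (fun y y' => C * ((ℓ : ℝ) + 1) ^ y.1.1 * Real.exp (-(δ₀ / 2 * (geomT D).dist y y')))) ∧
        HasMajorant (g := geomT D) (blkOf D.toDomains)
          (Matrix.toLin' (perLapT (N0 ℓ Mh k P) * gmlT (N0 ℓ Mh k P) ℓ k D.lev a))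
          (fun y y' => C * Real.exp (-(δ₀ / 2 * (geomT D).dist y y'))) := by
  obtain ⟨δa, Ca, Ma, Na, hδa, hCa, hMa, hNa, h1⟩ := prop22_first_multiLevelTorus d ℓ hℓ aminus aplus a2minus a2plus ha ha2
  obtain ⟨δb, Cb, Mb, Nb, hδb, hCb, hMb, hNb, h2⟩ := prop22_second_multiLevelTorus d ℓ hℓ aminus aplus a2minus a2plus ha ha2
  obtain ⟨δc, Cc, Mc, Nc, hδc, hCc, hMc, hNc, h3⟩ := prop22_third_multiLevelTorus d ℓ hℓ aminus aplus a2minus a2plus ha ha2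
  obtain ⟨δe, Ce, Me, Ne, hδe, hCe, hMe, hNe, h6⟩ := prop22_sixth_multiLevelTorus d ℓ hℓ aminus aplus a2minus a2plus ha ha2
  -- common rate (the smallest), constant and thresholds (the largest)
  set δ₀ : ℝ := min (min δa δb) (min δc δe) with hδ₀
  set C : ℝ := max (max Ca Cb) (max Cc Ce) with hC
  set M₀ : ℝ := max (max Ma Mb) (max Mc Me) with hM₀
  set N₀ : ℕ := max (max Na Nb) (max Nc Ne) with hN₀
  have hδ₀pos : 0 < δ₀ := lt_min (lt_min hδa hδb) (lt_min hδc hδe)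
  have hCpos : 0 < C := lt_max_of_lt_left (lt_max_of_lt_left hCa)
  have hM₀pos : 0 < M₀ := lt_max_of_lt_left (lt_max_of_lt_left hMa)
  have hN₀pos : 0 < N₀ := lt_max_of_lt_left (lt_max_of_lt_left hNa)
  refine ⟨δ₀, C, M₀, N₀, hδ₀pos, hCpos, hM₀pos, hN₀pos, ?_⟩
  intro k Mh R hMh hM hRL hRM P hP hP4 D a c haw hcw hac
  have hMh1 : 1 ≤ Mh := le_trans (by norm_num) hMh
  have hdnn : ∀ y y' : (geomT D).Site, 0 ≤ (geomT D).dist y y' := (triangle_refl_nonneg_T D hMh1 hP).2.2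
  -- the individual thresholds follow from the common ones
  have hδa' : δ₀ ≤ δa := (min_le_left _ _).trans (min_le_left _ _)
  have hδb' : δ₀ ≤ δb := (min_le_left _ _).trans (min_le_right _ _)
  have hδc' : δ₀ ≤ δc := (min_le_right _ _).trans (min_le_left _ _)
  have hδe' : δ₀ ≤ δe := (min_le_right _ _).trans (min_le_right _ _)
  have hCa' : Ca ≤ C := (le_max_left _ _).trans (le_max_left _ _)
  have hCb' : Cb ≤ C := (le_max_right _ _).trans (le_max_left _ _)
  have hCc' : Cc ≤ C := (le_max_left _ _).trans (le_max_right _ _)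
  have hCe' : Ce ≤ C := (le_max_right _ _).trans (le_max_right _ _)
  have hMa' : Ma ≤ ((ℓ : ℝ) + 1) * Mh := ((le_max_left _ _).trans (le_max_left _ _)).trans hM
  have hMb' : Mb ≤ ((ℓ : ℝ) + 1) * Mh := ((le_max_right _ _).trans (le_max_left _ _)).trans hM
  have hMc' : Mc ≤ ((ℓ : ℝ) + 1) * Mh := ((le_max_left _ _).trans (le_max_right _ _)).trans hM
  have hMe' : Me ≤ ((ℓ : ℝ) + 1) * Mh := ((le_max_right _ _).trans (le_max_right _ _)).trans hM
  have hNa' : Na + 1 ≤ R * ((ℓ + 1) * Mh) :=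
    le_trans (Nat.succ_le_succ ((le_max_left Na Nb).trans (le_max_left _ _))) hRM
  have hNb' : Nb + 1 ≤ R * ((ℓ + 1) * Mh) :=
    le_trans (Nat.succ_le_succ ((le_max_right Na Nb).trans (le_max_left _ _))) hRM
  have hNc' : Nc + 1 ≤ R * ((ℓ + 1) * Mh) :=
    le_trans (Nat.succ_le_succ ((le_max_left Nc Ne).trans (le_max_right _ _))) hRM
  have hNe' : Ne + 1 ≤ R * ((ℓ + 1) * Mh) :=
    le_trans (Nat.succ_le_succ ((le_max_right Nc Ne).trans (le_max_right _ _))) hRM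
  -- the weakening of a rate / constant to the common ones
  have hweak : ∀ (δ C' : ℝ), δ₀ ≤ δ → 0 ≤ C' → C' ≤ C → ∀ (p : ℝ), 0 ≤ p → ∀ y y' : (geomT D).Site,
      C' * p * Real.exp (-(δ / 2 * (geomT D).dist y y')) ≤ C * p * Real.exp (-(δ₀ / 2 * (geomT D).dist y y')) := by
    intro δ C' hδ hC0 hCle p hp y y'
    have he : Real.exp (-(δ / 2 * (geomT D).dist y y')) ≤ Real.exp (-(δ₀ / 2 * (geomT D).dist y y')) := by
      rw [Real.exp_le_exp, neg_le_neg_iff]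
      exact mul_le_mul_of_nonneg_right (by linarith) (hdnn y y')
    exact mul_le_mul (mul_le_mul_of_nonneg_right hCle hp) he (Real.exp_pos _).le (by positivity)
  refine ⟨?_, fun μ => ?_, fun μ => ?_, ?_⟩
  · exact hasMajorant_mono (g := geomT D) (blkOf D.toDomains) (h1 k Mh R hMh hMa' hRL hNa' P hP hP4 D a c haw hcw hac)
      (fun y y' => hweak δa Ca hδa' hCa.le hCa' _ (by positivity) y y')
  · exact hasMajorant_mono (g := geomT D) (blkOf D.toDomains) (h2 k Mh R hMh hMb' hRL hNb' P hP hP4 D a c haw hcw hac μ)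
      (fun y y' => hweak δb Cb hδb' hCb.le hCb' _ (by positivity) y y')
  · exact hasMajorant_mono (g := geomT D) (blkOf D.toDomains) (h3 k Mh R hMh hMc' hRL hNc' P hP hP4 D a c haw hcw hac μ)
      (fun y y' => hweak δc Cc hδc' hCc.le hCc' _ (by positivity) y y')
  · exact hasMajorant_mono (g := geomT D) (blkOf D.toDomains) (h6 k Mh R hMh hMe' hRL hNe' P hP hP4 D a c haw hcw hac)
      (fun y y' => by
        have h := hweak δe Ce hδe' hCe.le hCe' 1 zero_le_one y y'
        simpa only [mul_one] using h)

/-! ## §2  (1.98), R-half, on `T_η` with the first entry discharged -/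

/-- **(1.98), R-HALF, AT U₀ = 1 ON THE `k`-LEVEL TORUS FAMILY WITH THE GENUINE FIRST PROP.-2.2 TORUS ENTRY** («|Rf|₍₋₂₎ ≦ B′₀|f|₍₋₂₎»,
every exponent `n`): for every `n` and all `C₁, δ₁ > 0` there are `B′₀, M₀ > 0`, `N₀ ≥ 1` such that for every member of the torus family
in print's regime (`M_h ≥ 3`, `L·M_h ≥ M₀`, `R ≥ 2L`, `RM ≥ N₀ + 1`, `P_μ ≥ 4`, weights in the windows with the recursion), EVERY `G` on
`𝔅` with the (2.87)-bound `|G(y, y′)| ≦ C₁(Lʲ)⁻⁴(L^{j′})^{−(d+1)}e^{−½δ₁d_T(y,y′)}`, every `f` with `|f(z)| ≦ S(L^{j(z)})⁻ⁿ` and every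
point `x`: `|(Pf)(x)| ≦ B′₀(L^{j(x)})⁻ⁿS` and **`|(Rf)(x)| ≦ B′₀(L^{j(x)})⁻ⁿS`** (`P = pProjMLT`, `R = rProjMLT = 1 − P` = [4] (3.25)) —
`B8Ineq198MultiLevelTorus.ineq198R_multiLevelTorus` with its majorant hypothesis discharged by §1.
[cite: Balaban1985RegularSpaces, (1.98) p.92, (1.27) p.80; Balaban1985BackgroundPropagators, (3.49) p.399, (3.47) p.398, (3.25) p.394; Balaban1984PropagatorsII, Prop. 2.2 (2.67) p.234 (first entry), Prop. 2.3 (2.87) p.238, p.224 (Ω₁ = T_η admitted)] -/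
theorem ineq198R_multiLevelTorus_P22 (d ℓ : ℕ) (hℓ : 1 ≤ ℓ) (aminus aplus a2minus a2plus : ℝ) (ha : 0 < aminus)
    (ha2 : 0 < a2minus) {C₁ δ₁ : ℝ} (hC₁ : 0 < C₁) (hδ₁ : 0 < δ₁) (n : ℕ) :
    ∃ B₀' M₀ : ℝ, ∃ N₀ : ℕ, 0 < B₀' ∧ 0 < M₀ ∧ 0 < N₀ ∧
      ∀ (k Mh R : ℕ), 3 ≤ Mh → M₀ ≤ ((ℓ : ℝ) + 1) * Mh → 2 * (ℓ + 1) ≤ R → N₀ + 1 ≤ R * ((ℓ + 1) * Mh) →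
      ∀ (P : Fin (d + 1) → ℕ) (_hP : ∀ μ, 1 ≤ P μ) (_hP4 : ∀ μ, 4 ≤ P μ) (D : B6MultiLevelTorusOperatorL0.TDomains d ℓ Mh k P R) (a c : ℕ → ℝ),
        (∀ i, aminus ≤ a i ∧ a i ≤ aplus) → (∀ i, a2minus ≤ c i ∧ c i ≤ a2plus) →
        (∀ i, a (i + 1) = aNext ℓ (a i) (c i)) →
        ∀ G : Module.End ℝ (↥(bset D.toDomains) → ℝ),
          (∀ y y' : ↥(bset D.toDomains), |mat G y y' / W D.toDomains y'| ≤
            C₁ * (geomT D).len y ^ (-(4 : ℝ)) * (geomT D).len y' ^ (-((d + 1 : ℕ) : ℝ)) *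
              Real.exp (-(δ₁ / 2 * (geomT D).dist y y'))) →
          ∀ (f : ↥(boxDom (N0 ℓ Mh k P)) → ℝ) (S : ℝ), 0 ≤ S →
            (∀ z : ↥(boxDom (N0 ℓ Mh k P)), |f z| ≤ S * ((((ℓ : ℝ) + 1) ^ D.lev z.1) ^ n)⁻¹) →
            ∀ x : ↥(boxDom (N0 ℓ Mh k P)),
              |pProjMLT D a G f x| ≤ B₀' * ((((ℓ : ℝ) + 1) ^ D.lev x.1) ^ n)⁻¹ * S ∧
              |rProjMLT D a G f x| ≤ B₀' * ((((ℓ : ℝ) + 1) ^ D.lev x.1) ^ n)⁻¹ * S := by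
  obtain ⟨δ₀, C, M₀, N₀, hδ₀, hC, hM₀, hN₀, hE⟩ :=
    prop22_entries1236_multiLevelTorus d ℓ hℓ aminus aplus a2minus a2plus ha ha2
  obtain ⟨B₀', N₁, hB, hN₁, hmain⟩ := ineq198R_multiLevelTorus d ℓ hC hδ₀ hC₁ hδ₁ n
  refine ⟨B₀', M₀, max N₀ N₁, hB, hM₀, lt_max_of_lt_left hN₀, ?_⟩
  intro k Mh R hMh hM hRL hRM P hP hP4 D a c haw hcw hac G hG f S hS hf x
  have hMh1 : 1 ≤ Mh := le_trans (by norm_num) hMh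
  have hRM0 : N₀ + 1 ≤ R * ((ℓ + 1) * Mh) := le_trans (Nat.succ_le_succ (le_max_left _ _)) hRM
  have hRM1 : N₁ + 1 ≤ R * ((ℓ + 1) * Mh) := le_trans (Nat.succ_le_succ (le_max_right _ _)) hRM
  obtain ⟨hTG, -, -, -⟩ := hE k Mh R hMh hM hRL hRM0 P hP hP4 D a c haw hcw hac
  exact hmain k Mh R hMh1 hRM1 P hP D a hTG G hG f S hS hf x

/-! ## §3  (1.101) at U₀ = 1 on `T_η`, HYPOTHESIS-FREE -/

/-- **(1.101) AT U₀ = 1 ON PRINT'S CARRIER `T_η`, HYPOTHESIS-FREE — «G′ is a bounded operator from a space with the norm |·|₍₋₂₎ into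
a space with the norm |·| for functions, and the norm |·|₍₋₁₎ for their first derivatives», here for every input exponent `−n`**:
there are `C′, M₀ > 0`, `N₀ ≥ 1` (functions of `d`, `ℓ`, the windows, `n`) such that for every member of the `k`-level torus family in
print's regime, the GENUINE multi-level torus `G′ = gmlT`, `∇_μ = dT N₀ μ` and `−Δ_T = perLapT N₀` satisfy, for every `f` with
`|f(z)| ≦ S·(L^{j(z)})⁻ⁿ` and every point `x` at its level `j`: `|(G′f)(x)| ≦ C′(Lʲ)²(Lʲ)⁻ⁿS`, `|(∇_μG′f)(x)| ≦ C′Lʲ(Lʲ)⁻ⁿS`,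
`|(G′∇_μ^*f)(x)| ≦ C′Lʲ(Lʲ)⁻ⁿS` (every axis), `|((−Δ_T)G′f)(x)| ≦ C′(Lʲ)⁻ⁿS` — `B8Ineq198MultiLevelTorus.ineq1101_multiLevelTorus` with
ALL FOUR Prop.-2.2 hypotheses discharged by §1; no majorant, no inverse enters.
[cite: Balaban1985RegularSpaces, (1.101) p.93; Balaban1985BackgroundPropagators, Theorem 3.1 (3.42) p.397, (3.47) p.398, (3.41) p.397; Balaban1984PropagatorsII, Prop. 2.2 (2.67) p.234 (entries 1, 2, 3, 6), Lemma 2.1 (2.60)–(2.61) p.234, p.224 (Ω₁ = T_η admitted)] -/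
theorem ineq1101_multiLevelTorus_P22 (d ℓ : ℕ) (hℓ : 1 ≤ ℓ) (aminus aplus a2minus a2plus : ℝ) (ha : 0 < aminus)
    (ha2 : 0 < a2minus) (n : ℕ) :
    ∃ C' M₀ : ℝ, ∃ N₀ : ℕ, 0 < C' ∧ 0 < M₀ ∧ 0 < N₀ ∧
      ∀ (k Mh R : ℕ), 3 ≤ Mh → M₀ ≤ ((ℓ : ℝ) + 1) * Mh → 2 * (ℓ + 1) ≤ R → N₀ + 1 ≤ R * ((ℓ + 1) * Mh) →
      ∀ (P : Fin (d + 1) → ℕ) (_hP : ∀ μ, 1 ≤ P μ) (_hP4 : ∀ μ, 4 ≤ P μ) (D : B6MultiLevelTorusOperatorL0.TDomains d ℓ Mh k P R) (a c : ℕ → ℝ),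
        (∀ i, aminus ≤ a i ∧ a i ≤ aplus) → (∀ i, a2minus ≤ c i ∧ c i ≤ a2plus) →
        (∀ i, a (i + 1) = aNext ℓ (a i) (c i)) →
        ∀ (f : ↥(boxDom (N0 ℓ Mh k P)) → ℝ) (S : ℝ), 0 ≤ S →
          (∀ z : ↥(boxDom (N0 ℓ Mh k P)), |f z| ≤ S * ((((ℓ : ℝ) + 1) ^ D.lev z.1) ^ n)⁻¹) →
          ∀ x : ↥(boxDom (N0 ℓ Mh k P)),
            |(gmlT (N0 ℓ Mh k P) ℓ k D.lev a *ᵥ f) x| ≤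
              C' * (((ℓ : ℝ) + 1) ^ D.lev x.1) ^ 2 * ((((ℓ : ℝ) + 1) ^ D.lev x.1) ^ n)⁻¹ * S ∧
            (∀ μ : Fin (d + 1), |(dT (N0 ℓ Mh k P) μ *ᵥ (gmlT (N0 ℓ Mh k P) ℓ k D.lev a *ᵥ f)) x| ≤
              C' * ((ℓ : ℝ) + 1) ^ D.lev x.1 * ((((ℓ : ℝ) + 1) ^ D.lev x.1) ^ n)⁻¹ * S) ∧
            (∀ μ : Fin (d + 1), |(gmlT (N0 ℓ Mh k P) ℓ k D.lev a *ᵥ ((dT (N0 ℓ Mh k P) μ)ᵀ *ᵥ f)) x| ≤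
              C' * ((ℓ : ℝ) + 1) ^ D.lev x.1 * ((((ℓ : ℝ) + 1) ^ D.lev x.1) ^ n)⁻¹ * S) ∧
            |(perLapT (N0 ℓ Mh k P) *ᵥ (gmlT (N0 ℓ Mh k P) ℓ k D.lev a *ᵥ f)) x| ≤
              C' * ((((ℓ : ℝ) + 1) ^ D.lev x.1) ^ n)⁻¹ * S := by
  obtain ⟨δ₀, C, M₀, N₀, hδ₀, hC, hM₀, hN₀, hE⟩ :=
    prop22_entries1236_multiLevelTorus d ℓ hℓ aminus aplus a2minus a2plus ha ha2
  obtain ⟨C', N₁, hC', hN₁, hmain⟩ := ineq1101_multiLevelTorus d ℓ hC hδ₀ n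
  refine ⟨C', M₀, max N₀ N₁, hC', hM₀, lt_max_of_lt_left hN₀, ?_⟩
  intro k Mh R hMh hM hRL hRM P hP hP4 D a c haw hcw hac f S hS hf x
  have hMh1 : 1 ≤ Mh := le_trans (by norm_num) hMh
  have hRM0 : N₀ + 1 ≤ R * ((ℓ + 1) * Mh) := le_trans (Nat.succ_le_succ (le_max_left _ _)) hRM
  have hRM1 : N₁ + 1 ≤ R * ((ℓ + 1) * Mh) := le_trans (Nat.succ_le_succ (le_max_right _ _)) hRM
  obtain ⟨hTG, hTD, hTA, hTL⟩ := hE k Mh R hMh hM hRL hRM0 P hP hP4 D a c haw hcw hac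
  exact hmain k Mh R hMh1 hRM1 P hP D a (fun μ => dT (N0 ℓ Mh k P) μ) (perLapT (N0 ℓ Mh k P)) hTG hTD hTA hTL f S hS hf x

/-- **(1.101) AT U₀ = 1 ON `T_η`, HYPOTHESIS-FREE, `n = 2` — THE PRINTED SENTENCE**: `|(G′f)(x)| ≦ C′S`, `|(∇_μG′f)(x)| ≦ C′(Lʲ)⁻¹S`,
`|(G′∇_μ^*f)(x)| ≦ C′(Lʲ)⁻¹S`, `|((−Δ_T)G′f)(x)| ≦ C′(Lʲ)⁻²S` whenever `|f(z)| ≦ S(L^{j(z)})⁻²`, for the genuine multi-level torus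
`G′ = gmlT`, `∇_μ = dT N₀ μ`, `−Δ_T = perLapT N₀` on every member of the family in print's regime.
[cite: Balaban1985RegularSpaces, (1.101) p.93; Balaban1985BackgroundPropagators, Theorem 3.1 (3.42) p.397, (3.47) p.398; Balaban1984PropagatorsII, Prop. 2.2 (2.67) p.234, p.224] -/
theorem ineq1101_multiLevelTorus_two_P22 (d ℓ : ℕ) (hℓ : 1 ≤ ℓ) (aminus aplus a2minus a2plus : ℝ) (ha : 0 < aminus)
    (ha2 : 0 < a2minus) :
    ∃ C' M₀ : ℝ, ∃ N₀ : ℕ, 0 < C' ∧ 0 < M₀ ∧ 0 < N₀ ∧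
      ∀ (k Mh R : ℕ), 3 ≤ Mh → M₀ ≤ ((ℓ : ℝ) + 1) * Mh → 2 * (ℓ + 1) ≤ R → N₀ + 1 ≤ R * ((ℓ + 1) * Mh) →
      ∀ (P : Fin (d + 1) → ℕ) (_hP : ∀ μ, 1 ≤ P μ) (_hP4 : ∀ μ, 4 ≤ P μ) (D : B6MultiLevelTorusOperatorL0.TDomains d ℓ Mh k P R) (a c : ℕ → ℝ),
        (∀ i, aminus ≤ a i ∧ a i ≤ aplus) → (∀ i, a2minus ≤ c i ∧ c i ≤ a2plus) →
        (∀ i, a (i + 1) = aNext ℓ (a i) (c i)) →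
        ∀ (f : ↥(boxDom (N0 ℓ Mh k P)) → ℝ) (S : ℝ), 0 ≤ S →
          (∀ z : ↥(boxDom (N0 ℓ Mh k P)), |f z| ≤ S * ((((ℓ : ℝ) + 1) ^ D.lev z.1) ^ 2)⁻¹) →
          ∀ x : ↥(boxDom (N0 ℓ Mh k P)),
            |(gmlT (N0 ℓ Mh k P) ℓ k D.lev a *ᵥ f) x| ≤ C' * S ∧
            (∀ μ : Fin (d + 1), |(dT (N0 ℓ Mh k P) μ *ᵥ (gmlT (N0 ℓ Mh k P) ℓ k D.lev a *ᵥ f)) x| ≤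
              C' * (((ℓ : ℝ) + 1) ^ D.lev x.1)⁻¹ * S) ∧
            (∀ μ : Fin (d + 1), |(gmlT (N0 ℓ Mh k P) ℓ k D.lev a *ᵥ ((dT (N0 ℓ Mh k P) μ)ᵀ *ᵥ f)) x| ≤
              C' * (((ℓ : ℝ) + 1) ^ D.lev x.1)⁻¹ * S) ∧
            |(perLapT (N0 ℓ Mh k P) *ᵥ (gmlT (N0 ℓ Mh k P) ℓ k D.lev a *ᵥ f)) x| ≤
              C' * ((((ℓ : ℝ) + 1) ^ D.lev x.1) ^ 2)⁻¹ * S := by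
  obtain ⟨δ₀, C, M₀, N₀, hδ₀, hC, hM₀, hN₀, hE⟩ :=
    prop22_entries1236_multiLevelTorus d ℓ hℓ aminus aplus a2minus a2plus ha ha2
  obtain ⟨C', N₁, hC', hN₁, hmain⟩ := ineq1101_multiLevelTorus_two d ℓ hC hδ₀
  refine ⟨C', M₀, max N₀ N₁, hC', hM₀, lt_max_of_lt_left hN₀, ?_⟩
  intro k Mh R hMh hM hRL hRM P hP hP4 D a c haw hcw hac f S hS hf x
  have hMh1 : 1 ≤ Mh := le_trans (by norm_num) hMh
  have hRM0 : N₀ + 1 ≤ R * ((ℓ + 1) * Mh) := le_trans (Nat.succ_le_succ (le_max_left _ _)) hRM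
  have hRM1 : N₁ + 1 ≤ R * ((ℓ + 1) * Mh) := le_trans (Nat.succ_le_succ (le_max_right _ _)) hRM
  obtain ⟨hTG, hTD, hTA, hTL⟩ := hE k Mh R hMh hM hRL hRM0 P hP hP4 D a c haw hcw hac
  exact hmain k Mh R hMh1 hRM1 P hP D a (fun μ => dT (N0 ℓ Mh k P) μ) (perLapT (N0 ℓ Mh k P)) hTG hTD hTA hTL f S hS hf x

/-! ## §4  The composite letter `G′R` of (1.100)–(1.101) on `T_η` with the entries discharged -/

/-- **THE COMPOSITE LETTER `G′R` OF (1.100)–(1.101) AT U₀ = 1 ON THE `k`-LEVEL TORUS FAMILY WITH THE GENUINE PROP.-2.2 TORUS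
ENTRIES** («λ = G′RD\*A + G′R𝔉₄(λ, Dλ, A, D\*A) … |G′R𝔉|, |DG′R𝔉|₍₋₁₎ ≦ O(1)B′₀ξ₁(…) on Ω_j»): for all `C₁, δ₁ > 0` there are
`C″, M₀ > 0`, `N₀ ≥ 1` such that for every member of the family in print's regime, EVERY `G` on `𝔅` with the (2.87)-bound, every `f`
with `|f(z)| ≦ S(L^{j(z)})⁻²` and every point `x` at its level `j`: `|(G′Rf)(x)| ≦ C″S` and `|(∇_μG′Rf)(x)| ≦ C″(Lʲ)⁻¹S` (every axis;
`∇_μ = dT N₀ μ`, `R = rProjMLT`) — `B8Ineq198MultiLevelTorus.ineq1101_GR_multiLevelTorus` with its four majorant hypotheses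
discharged by §1; only the inverse `(Q′G′²Q′*)⁻¹` remains the argument `G`.
[cite: Balaban1985RegularSpaces, (1.100)–(1.101) p.93, (1.98) p.92; Balaban1985BackgroundPropagators, Theorem 3.1 p.397, (3.47) p.398, (3.49) p.399, (3.25) p.394; Balaban1984PropagatorsII, Prop. 2.2 (2.67) p.234, Prop. 2.3 (2.87) p.238, p.224] -/
theorem ineq1101_GR_multiLevelTorus_P22 (d ℓ : ℕ) (hℓ : 1 ≤ ℓ) (aminus aplus a2minus a2plus : ℝ) (ha : 0 < aminus)
    (ha2 : 0 < a2minus) {C₁ δ₁ : ℝ} (hC₁ : 0 < C₁) (hδ₁ : 0 < δ₁) :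
    ∃ C'' M₀ : ℝ, ∃ N₀ : ℕ, 0 < C'' ∧ 0 < M₀ ∧ 0 < N₀ ∧
      ∀ (k Mh R : ℕ), 3 ≤ Mh → M₀ ≤ ((ℓ : ℝ) + 1) * Mh → 2 * (ℓ + 1) ≤ R → N₀ + 1 ≤ R * ((ℓ + 1) * Mh) →
      ∀ (P : Fin (d + 1) → ℕ) (_hP : ∀ μ, 1 ≤ P μ) (_hP4 : ∀ μ, 4 ≤ P μ) (D : B6MultiLevelTorusOperatorL0.TDomains d ℓ Mh k P R) (a c : ℕ → ℝ),
        (∀ i, aminus ≤ a i ∧ a i ≤ aplus) → (∀ i, a2minus ≤ c i ∧ c i ≤ a2plus) →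
        (∀ i, a (i + 1) = aNext ℓ (a i) (c i)) →
        ∀ G : Module.End ℝ (↥(bset D.toDomains) → ℝ),
          (∀ y y' : ↥(bset D.toDomains), |mat G y y' / W D.toDomains y'| ≤
            C₁ * (geomT D).len y ^ (-(4 : ℝ)) * (geomT D).len y' ^ (-((d + 1 : ℕ) : ℝ)) *
              Real.exp (-(δ₁ / 2 * (geomT D).dist y y'))) →
          ∀ (f : ↥(boxDom (N0 ℓ Mh k P)) → ℝ) (S : ℝ), 0 ≤ S →
            (∀ z : ↥(boxDom (N0 ℓ Mh k P)), |f z| ≤ S * ((((ℓ : ℝ) + 1) ^ D.lev z.1) ^ 2)⁻¹) →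
            ∀ x : ↥(boxDom (N0 ℓ Mh k P)),
              |(gmlT (N0 ℓ Mh k P) ℓ k D.lev a *ᵥ rProjMLT D a G f) x| ≤ C'' * S ∧
              ∀ μ : Fin (d + 1), |(dT (N0 ℓ Mh k P) μ *ᵥ (gmlT (N0 ℓ Mh k P) ℓ k D.lev a *ᵥ rProjMLT D a G f)) x| ≤
                C'' * (((ℓ : ℝ) + 1) ^ D.lev x.1)⁻¹ * S := by
  obtain ⟨δ₀, C, M₀, N₀, hδ₀, hC, hM₀, hN₀, hE⟩ :=
    prop22_entries1236_multiLevelTorus d ℓ hℓ aminus aplus a2minus a2plus ha ha2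
  obtain ⟨C'', N₁, hC'', hN₁, hmain⟩ := ineq1101_GR_multiLevelTorus d ℓ hC hδ₀ hC₁ hδ₁
  refine ⟨C'', M₀, max N₀ N₁, hC'', hM₀, lt_max_of_lt_left hN₀, ?_⟩
  intro k Mh R hMh hM hRL hRM P hP hP4 D a c haw hcw hac G hG f S hS hf x
  have hMh1 : 1 ≤ Mh := le_trans (by norm_num) hMh
  have hRM0 : N₀ + 1 ≤ R * ((ℓ + 1) * Mh) := le_trans (Nat.succ_le_succ (le_max_left _ _)) hRM
  have hRM1 : N₁ + 1 ≤ R * ((ℓ + 1) * Mh) := le_trans (Nat.succ_le_succ (le_max_right _ _)) hRM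
  obtain ⟨hTG, hTD, hTA, hTL⟩ := hE k Mh R hMh hM hRL hRM0 P hP hP4 D a c haw hcw hac
  exact hmain k Mh R hMh1 hRM1 P hP D a (fun μ => dT (N0 ℓ Mh k P) μ) (perLapT (N0 ℓ Mh k P)) hTG hTD hTA hTL G hG f S hS hf x

/-! ## §5  In print's own norm `|·|₍α₎` of p. 86 -/

/-- **(1.98), R-HALF, IN PRINT'S OWN NORM ON `T_η` WITH THE GENUINE FIRST TORUS ENTRY — «|Rf|₍₋ₙ₎ ≦ B′₀|f|₍₋ₙ₎»** (and
`|Pf|₍₋ₙ₎ ≦ B′₀|f|₍₋ₙ₎`), `|·|₍α₎ = B8ScaledSupNorm.msup (ℓ+1) k 1 α (Ω_j = {z : j ≤ lev z})`, for every member of the family in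
print's regime and every `G` with the (2.87)-bound.
[cite: Balaban1985RegularSpaces, (1.98) p.92, p.86 (definition after (1.55)); Balaban1985BackgroundPropagators, (3.41) p.397, (3.49) p.399, (3.25) p.394; Balaban1984PropagatorsII, Prop. 2.2 (2.67) p.234, Prop. 2.3 (2.87) p.238] -/
theorem ineq198R_multiLevelTorus_msup_P22 (d ℓ : ℕ) (hℓ : 1 ≤ ℓ) (aminus aplus a2minus a2plus : ℝ) (ha : 0 < aminus)
    (ha2 : 0 < a2minus) {C₁ δ₁ : ℝ} (hC₁ : 0 < C₁) (hδ₁ : 0 < δ₁) (n : ℕ) :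
    ∃ B₀' M₀ : ℝ, ∃ N₀ : ℕ, 0 < B₀' ∧ 0 < M₀ ∧ 0 < N₀ ∧
      ∀ (k Mh R : ℕ), 3 ≤ Mh → M₀ ≤ ((ℓ : ℝ) + 1) * Mh → 2 * (ℓ + 1) ≤ R → N₀ + 1 ≤ R * ((ℓ + 1) * Mh) →
      ∀ (P : Fin (d + 1) → ℕ) (_hP : ∀ μ, 1 ≤ P μ) (_hP4 : ∀ μ, 4 ≤ P μ) (D : B6MultiLevelTorusOperatorL0.TDomains d ℓ Mh k P R) (a c : ℕ → ℝ),
        (∀ i, aminus ≤ a i ∧ a i ≤ aplus) → (∀ i, a2minus ≤ c i ∧ c i ≤ a2plus) →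
        (∀ i, a (i + 1) = aNext ℓ (a i) (c i)) →
        ∀ G : Module.End ℝ (↥(bset D.toDomains) → ℝ),
          (∀ y y' : ↥(bset D.toDomains), |mat G y y' / W D.toDomains y'| ≤
            C₁ * (geomT D).len y ^ (-(4 : ℝ)) * (geomT D).len y' ^ (-((d + 1 : ℕ) : ℝ)) *
              Real.exp (-(δ₁ / 2 * (geomT D).dist y y'))) →
          ∀ f : ↥(boxDom (N0 ℓ Mh k P)) → ℝ,
            msup (ℓ + 1) k 1 (-(n : ℝ)) (fun j (z : ↥(boxDom (N0 ℓ Mh k P))) => j ≤ D.lev z.1) (rProjMLT D a G f) ≤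
              B₀' * msup (ℓ + 1) k 1 (-(n : ℝ)) (fun j (z : ↥(boxDom (N0 ℓ Mh k P))) => j ≤ D.lev z.1) f ∧
            msup (ℓ + 1) k 1 (-(n : ℝ)) (fun j (z : ↥(boxDom (N0 ℓ Mh k P))) => j ≤ D.lev z.1) (pProjMLT D a G f) ≤
              B₀' * msup (ℓ + 1) k 1 (-(n : ℝ)) (fun j (z : ↥(boxDom (N0 ℓ Mh k P))) => j ≤ D.lev z.1) f := by
  obtain ⟨δ₀, C, M₀, N₀, hδ₀, hC, hM₀, hN₀, hE⟩ :=
    prop22_entries1236_multiLevelTorus d ℓ hℓ aminus aplus a2minus a2plus ha ha2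
  obtain ⟨B₀', N₁, hB, hN₁, hmain⟩ := ineq198R_multiLevelTorus_msup d ℓ hC hδ₀ hC₁ hδ₁ n
  refine ⟨B₀', M₀, max N₀ N₁, hB, hM₀, lt_max_of_lt_left hN₀, ?_⟩
  intro k Mh R hMh hM hRL hRM P hP hP4 D a c haw hcw hac G hG f
  have hMh1 : 1 ≤ Mh := le_trans (by norm_num) hMh
  have hRM0 : N₀ + 1 ≤ R * ((ℓ + 1) * Mh) := le_trans (Nat.succ_le_succ (le_max_left _ _)) hRM
  have hRM1 : N₁ + 1 ≤ R * ((ℓ + 1) * Mh) := le_trans (Nat.succ_le_succ (le_max_right _ _)) hRM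
  obtain ⟨hTG, -, -, -⟩ := hE k Mh R hMh hM hRL hRM0 P hP hP4 D a c haw hcw hac
  exact hmain k Mh R hMh1 hRM1 P hP D a hTG G hG f

/-- **(1.101) IN PRINT'S OWN NORMS ON `T_η`, HYPOTHESIS-FREE** — «G′ is a bounded operator from a space with the norm |·|₍₋₂₎ into a
space with the norm |·| for functions, and the norm |·|₍₋₁₎ for their first derivatives»: `|G′f|₍₀₎ ≦ C′|f|₍₋₂₎`,
`|∇_μG′f|₍₋₁₎ ≦ C′|f|₍₋₂₎`, `|G′∇_μ^*f|₍₋₁₎ ≦ C′|f|₍₋₂₎`, `|(−Δ_T)G′f|₍₋₂₎ ≦ C′|f|₍₋₂₎` in the typed p. 86 norm, for the genuine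
multi-level torus `G′ = gmlT`, `∇_μ = dT N₀ μ`, `−Δ_T = perLapT N₀` on every member of the family in print's regime.
[cite: Balaban1985RegularSpaces, (1.101) p.93, p.86 (definition after (1.55)); Balaban1985BackgroundPropagators, Theorem 3.1 (3.42) p.397, (3.47) p.398, (3.41) p.397; Balaban1984PropagatorsII, Prop. 2.2 (2.67) p.234 (entries 1, 2, 3, 6), p.224] -/
theorem ineq1101_multiLevelTorus_msup_P22 (d ℓ : ℕ) (hℓ : 1 ≤ ℓ) (aminus aplus a2minus a2plus : ℝ) (ha : 0 < aminus)
    (ha2 : 0 < a2minus) :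
    ∃ C' M₀ : ℝ, ∃ N₀ : ℕ, 0 < C' ∧ 0 < M₀ ∧ 0 < N₀ ∧
      ∀ (k Mh R : ℕ), 3 ≤ Mh → M₀ ≤ ((ℓ : ℝ) + 1) * Mh → 2 * (ℓ + 1) ≤ R → N₀ + 1 ≤ R * ((ℓ + 1) * Mh) →
      ∀ (P : Fin (d + 1) → ℕ) (_hP : ∀ μ, 1 ≤ P μ) (_hP4 : ∀ μ, 4 ≤ P μ) (D : B6MultiLevelTorusOperatorL0.TDomains d ℓ Mh k P R) (a c : ℕ → ℝ),
        (∀ i, aminus ≤ a i ∧ a i ≤ aplus) → (∀ i, a2minus ≤ c i ∧ c i ≤ a2plus) →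
        (∀ i, a (i + 1) = aNext ℓ (a i) (c i)) →
        ∀ f : ↥(boxDom (N0 ℓ Mh k P)) → ℝ,
          msup (ℓ + 1) k 1 0 (fun j (z : ↥(boxDom (N0 ℓ Mh k P))) => j ≤ D.lev z.1)
              (gmlT (N0 ℓ Mh k P) ℓ k D.lev a *ᵥ f) ≤
            C' * msup (ℓ + 1) k 1 (-2) (fun j (z : ↥(boxDom (N0 ℓ Mh k P))) => j ≤ D.lev z.1) f ∧
          (∀ μ : Fin (d + 1), msup (ℓ + 1) k 1 (-1) (fun j (z : ↥(boxDom (N0 ℓ Mh k P))) => j ≤ D.lev z.1)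
              (dT (N0 ℓ Mh k P) μ *ᵥ (gmlT (N0 ℓ Mh k P) ℓ k D.lev a *ᵥ f)) ≤
            C' * msup (ℓ + 1) k 1 (-2) (fun j (z : ↥(boxDom (N0 ℓ Mh k P))) => j ≤ D.lev z.1) f) ∧
          (∀ μ : Fin (d + 1), msup (ℓ + 1) k 1 (-1) (fun j (z : ↥(boxDom (N0 ℓ Mh k P))) => j ≤ D.lev z.1)
              (gmlT (N0 ℓ Mh k P) ℓ k D.lev a *ᵥ ((dT (N0 ℓ Mh k P) μ)ᵀ *ᵥ f)) ≤
            C' * msup (ℓ + 1) k 1 (-2) (fun j (z : ↥(boxDom (N0 ℓ Mh k P))) => j ≤ D.lev z.1) f) ∧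
          msup (ℓ + 1) k 1 (-2) (fun j (z : ↥(boxDom (N0 ℓ Mh k P))) => j ≤ D.lev z.1)
              (perLapT (N0 ℓ Mh k P) *ᵥ (gmlT (N0 ℓ Mh k P) ℓ k D.lev a *ᵥ f)) ≤
            C' * msup (ℓ + 1) k 1 (-2) (fun j (z : ↥(boxDom (N0 ℓ Mh k P))) => j ≤ D.lev z.1) f := by
  obtain ⟨δ₀, C, M₀, N₀, hδ₀, hC, hM₀, hN₀, hE⟩ :=
    prop22_entries1236_multiLevelTorus d ℓ hℓ aminus aplus a2minus a2plus ha ha2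
  obtain ⟨C', N₁, hC', hN₁, hmain⟩ := ineq1101_multiLevelTorus_msup d ℓ hC hδ₀
  refine ⟨C', M₀, max N₀ N₁, hC', hM₀, lt_max_of_lt_left hN₀, ?_⟩
  intro k Mh R hMh hM hRL hRM P hP hP4 D a c haw hcw hac f
  have hMh1 : 1 ≤ Mh := le_trans (by norm_num) hMh
  have hRM0 : N₀ + 1 ≤ R * ((ℓ + 1) * Mh) := le_trans (Nat.succ_le_succ (le_max_left _ _)) hRM
  have hRM1 : N₁ + 1 ≤ R * ((ℓ + 1) * Mh) := le_trans (Nat.succ_le_succ (le_max_right _ _)) hRM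
  obtain ⟨hTG, hTD, hTA, hTL⟩ := hE k Mh R hMh hM hRL hRM0 P hP hP4 D a c haw hcw hac
  exact hmain k Mh R hMh1 hRM1 P hP D a (fun μ => dT (N0 ℓ Mh k P) μ) (perLapT (N0 ℓ Mh k P)) hTG hTD hTA hTL f

end

end Literature.MathematicalPhysics.QuantumFieldTheory.Balaban1983to89.B8Ineq198MultiLevelTorusP22L0
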